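import Summits.QuantumFields.BalabanUV.T4Continuum.Support.VariationalCovariantTwoRunsEnd
import Summits.QuantumFields.BalabanUV.T4Continuum.Support.VariationalCovariantScalarPairLocal

/-!
# T⁴ programme, spine node NE2 (U1a), lane P2 — THE FRAME-FREE ENDS (single nested tower AND two runs): leaf P⁺ taken PER UNIT BLOCK
# from the reference transport's in-block defect and the relative phase (leaf-01-g4's `VariationalCovariantPoincareLocal` p215015 +
# `VariationalCovariantScalarPairLocal`, frame-free and relative), so NO global small-field frame remains among the binders
# (road owner `b2b-balaban-t4-ne2-p2` gen 11; `t4/skeletons/NE2-t4-ne2-p2.md` v0.13 §0 / §4(c) / §7 (O12))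

WHAT CHANGES w.r.t. `VariationalCovariantEndRel.towerLimitRate_scalarTower_closed_rel` (p215080) and `VariationalCovariantTwoRunsEnd.
towerLimitRate_twoRuns_closed` (p215328): the TEN frame binders per level (`G, c, m_G, m_B, G′, c′, m_G′, m_B′` with their two smallnesses)
DISAPPEAR; in their place the per-block smallness `2d(n·w_k)² + 4γ² ≤ ½` (reference in-block defect + relative phase), the one-step smallness
`2d(L·m₁,k)² ≤ ½`, and the FED⁺ absorption in leaf-01-g4's normalisation `64d(n·m_k)² ≤ ½`; `1 ≤ d`.  The conclusions are LITERALLY the same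
(`scalar_pair_closed_local` states p213521's `let` telescope with `C_P = 1088d + 128`, weakened from 136 inside), so p213959's
`towerLimitRate_of_closedBrackets` and p215328's `towerLimitRate_twoRuns_of_brackets` apply verbatim.  Honest limit §4(c) of the skeleton
now reads: «small field PER UNIT BLOCK (k-uniform: n·w₀, γ, n·m, L·m₁ small) — no global frame, no global gauge».

HONEST FRAMING (T4-DAG p. 1).  Rung (B)+1 only — NOT infinite volume, NOT a mass gap, NOT Clay.  NE2 is NOT IN PRINT and NOT proved here.
MODEL LEVEL (U(1) charged scalar = King's (2.14) species WITH background; phases, transports, defects = DATA; NE3 = the two-run CLASS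
hypotheses, not discharged); scalar sector; plumbing, [folklore]; no `def`; no `def … : Prop`; no `sorry`; axioms standard.
HONEST DEPENDENCY (cell, verbatim): continuum YM on T⁴ ⇐ BetaPertH ∧ nine spine estimates (0/9 proved); BetaPertH ⇐ (D1) ∧ (D4) ∧
CAP+tail; G-an2-4 gates asym, D1 and NE2/3/4.
-/

noncomputable section

open scoped Matrix ComplexConjugate ComplexOrder Matrix.Norms.L2Operator BigOperators

namespace Summit.QuantumFields.BalabanUV.T4Continuum.VariationalCovariantEndLocal

open Summit.QuantumFields.BalabanUV.T4Continuum.VariationalTransfer (blockSpin)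
open Summit.QuantumFields.BalabanUV.T4Continuum.VariationalCovariantEffective (effSc)
open Summit.QuantumFields.BalabanUV.T4Continuum.VariationalCovariantTower (compT Rtr)
open Summit.QuantumFields.BalabanUV.T4Continuum.VariationalCovariantTowerLaw (eFED eONE eUB eFED_nonneg)
open Summit.QuantumFields.BalabanUV.T4Continuum.VariationalCovariantEnd
  (lamC cR lamF delta eps1 deltaP lamLevel eLevel ePLevel cEnd lamC_nonneg cEnd_nonneg level_facts level_defects_le
   towerLimitRate_of_closedBrackets)
open Summit.QuantumFields.BalabanUV.T4Continuum.VariationalCovariantTwoRunsEnd (eLip cLip cTwoRuns eLip_le towerLimitRate_twoRuns_of_brackets)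
open Summit.QuantumFields.BalabanUV.T4Continuum.VariationalCovariantUpperBoundRel (exists_ub_scalarPair_rel_eff)
open Summit.QuantumFields.BalabanUV.T4Continuum.VariationalCovariantLipschitzRepair (scalar_repair_abs)
open Summit.QuantumFields.BalabanUV.T4Continuum.VariationalCovariantScalarPairLocal (scalar_pair_closed_local)
open Summit.QuantumFields.BalabanUV.T4Continuum.VariationalCovariantPoincareLocal (qW_le_coarse_rel)
open Summit.QuantumFields.BalabanUV.T4Continuum.CovariantAveragingTower (TowerLimitRate)
open Summit.QuantumFields.BalabanUV.T4Continuum.VariationalCovariantFederbush (mis)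
open Literature.MathematicalPhysics.QuantumFieldTheory.Balaban1983to89.B5Prop11Lower (nsq nsq_nonneg)
open Literature.MathematicalPhysics.QuantumFieldTheory.Balaban1983to89.B5Prop11Plancherel (Tor fine unitVec)
open Literature.MathematicalPhysics.QuantumFieldTheory.Balaban1983to89.B5Block118 (bpt)
open Summit.QuantumFields.BalabanUV.T4Continuum.VariationalCovariantScalarPair (Sc Sf qW Qk Q1 Sc_nonneg)

variable {d : ℕ}

/-- the local P⁺ constant `136` is dominated by the frame constant `1088d + 128` for `1 ≤ d`. [folklore] -/
theorem qW_le_coarse_rel_weak (n : ℕ) [NeZero n] (M : Fin d → ℕ) [∀ μ, NeZero (M μ)] (hd : 1 ≤ d)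
    {Rc : Tor (fine n M) → Fin d → ℂ} {T T₀ : Tor (fine n M) → ℂ} (hT₀ : ∀ x, ‖T₀ x‖ = 1) {w₀ γ : ℝ}
    (hw₀ : ∀ (y : Tor M) (j : Fin d → Fin n) (μ : Fin d), (j μ : ℕ) + 1 < n →
      ‖Rc (bpt n M y j) μ * conj (T₀ (bpt n M y j + unitVec (fine n M) μ)) * T₀ (bpt n M y j) - 1‖ ≤ w₀)
    (hrel : ∀ x, ‖T x * conj (T₀ x) - 1‖ ≤ γ)
    (hsmall : 2 * (d : ℝ) * ((n : ℝ) * w₀) ^ 2 + 4 * γ ^ 2 ≤ 1 / 2) (f : Tor (fine n M) → ℂ) :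
    qW n M f ≤ (1088 * (d : ℝ) + 128) * (Sc n M Rc f + nsq (Qk n M T f)) := by
  have h := qW_le_coarse_rel n M hT₀ hw₀ hrel hsmall f
  have hd' : (1 : ℝ) ≤ d := by exact_mod_cast hd
  have h0 : 0 ≤ Sc n M Rc f + nsq (Qk n M T f) := add_nonneg (Sc_nonneg n M Rc f) (nsq_nonneg _)
  nlinarith

section Local

variable (L : ℕ) [NeZero L] (M : Fin d → ℕ) [hM : ∀ μ, NeZero (M μ)]
variable (Rc : (k : ℕ) → Tor (fine (L ^ k) M) → Fin d → ℂ) (T T₀ : (k : ℕ) → Tor (fine (L ^ k) M) → ℂ)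
variable (R' : (k : ℕ) → Tor (fine L (fine (L ^ k) M)) → Fin d → ℂ) (T' : (k : ℕ) → Tor (fine L (fine (L ^ k) M)) → ℂ)
variable (m w w' a m₁ : ℕ → ℝ)

/-- **THE FRAME-FREE END (single nested tower).**  As `towerLimitRate_scalarTower_closed_rel` (p215080) WITHOUT frames: binders =
unit-modulus data, COMP⁺, the reference transports `T₀ k` (in-block defect `w_k`) with relative phase `≤ γ` and per-block smallness
`2d(n w_k)² + 4γ² ≤ ½`, the one-block mismatch `m_k` with `64d(n m_k)² ≤ ½`, plaquette defect `a_k`, one-step defects `m₁,k` with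
`2d(L m₁,k)² ≤ ½`, the fictitious `w′_k`, CLASS, `1 ≤ d`, `2 ≤ L`, `0 < a₀` ⟹ `TowerLimitRate (fun _ ↦ 1) 1 (k ↦ effSc (L^k) M (Rc k) (T k) a₀)
(cEnd d L c_w′ c_a c_m c₁) L⁻¹`.  NO frame, NO leaf binder, NO NE3; NE2 NOT proved. [folklore] -/
theorem towerLimitRate_scalarTower_closed_local (hd : 1 ≤ d) (hL : 2 ≤ L)
    (hT : ∀ k x, ‖T k x‖ = 1) (hRc1 : ∀ k y μ, ‖Rc k y μ‖ = 1) (hR' : ∀ k x μ, ‖R' k x μ‖ ≤ 1) (hT'1 : ∀ k x, ‖T' k x‖ = 1)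
    (hTcomp : ∀ k, T (k + 1) = compT (L ^ k) L M (T k) (T' k)) (hRtr : ∀ k, Rc (k + 1) = Rtr (L ^ k) L M (R' k))
    (hm : ∀ k, 0 ≤ m k) (hmis : ∀ k y μ j, ‖mis L (fine (L ^ k) M) (Rc k) (R' k) (T' k) y μ j‖ ≤ m k)
    (habsorb : ∀ k, 64 * (d : ℝ) * ((((L ^ k : ℕ)) : ℝ) * m k) ^ 2 ≤ 1 / 2)
    (hT₀ : ∀ k x, ‖T₀ k x‖ = 1) (hw : ∀ k, 0 ≤ w k)
    (hwin : ∀ k (y : Tor M) (j : Fin d → Fin (L ^ k)) (μ : Fin d), (j μ : ℕ) + 1 < L ^ k →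
      ‖Rc k (bpt (L ^ k) M y j) μ * (starRingEnd ℂ) (T₀ k (bpt (L ^ k) M y j + unitVec (fine (L ^ k) M) μ)) * T₀ k (bpt (L ^ k) M y j) - 1‖
        ≤ w k)
    {γ : ℝ} (hγ : γ < 1) (hrel : ∀ k x, ‖T k x * (starRingEnd ℂ) (T₀ k x) - 1‖ ≤ γ)
    (hsmall : ∀ k, 2 * (d : ℝ) * ((((L ^ k : ℕ)) : ℝ) * w k) ^ 2 + 4 * γ ^ 2 ≤ 1 / 2)
    (hw'0 : ∀ k, 0 ≤ w' k) (hw' : ∀ k, (4 + (((L ^ k : ℕ)) : ℝ) * w k) / (1 - γ) - 1 ≤ (((L ^ k : ℕ)) : ℝ) * w' k)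
    (ha : ∀ k, 0 ≤ a k)
    (hP : ∀ k x μ ν, ‖Rc k x μ * Rc k (x + unitVec (fine (L ^ k) M) μ) ν - Rc k x ν * Rc k (x + unitVec (fine (L ^ k) M) ν) μ‖ ≤ a k)
    (hm₁ : ∀ k, 0 ≤ m₁ k)
    (hin : ∀ k (y : Tor (fine (L ^ k) M)) (j : Fin d → Fin L) (μ : Fin d), (j μ : ℕ) + 1 < L →
      ‖R' k (bpt L (fine (L ^ k) M) y j) μ * (starRingEnd ℂ) (T' k (bpt L (fine (L ^ k) M) y j + unitVec (fine L (fine (L ^ k) M)) μ))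
          * T' k (bpt L (fine (L ^ k) M) y j) - 1‖ ≤ m₁ k)
    (hcross : ∀ k (y : Tor (fine (L ^ k) M)) (j : Fin d → Fin L) (μ : Fin d), (j μ : ℕ) + 1 = L →
      ‖R' k (bpt L (fine (L ^ k) M) y j) μ * (starRingEnd ℂ) (T' k (bpt L (fine (L ^ k) M) y j + unitVec (fine L (fine (L ^ k) M)) μ))
          * T' k (bpt L (fine (L ^ k) M) y j) - Rc k y μ‖ ≤ m₁ k)
    (hsmall₁ : ∀ k, 2 * (d : ℝ) * ((L : ℝ) * m₁ k) ^ 2 ≤ 1 / 2)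
    {cw ca cm c₁ : ℝ}
    (hwc : ∀ k, (((L ^ k : ℕ)) : ℝ) * w' k ≤ cw) (hac : ∀ k, a k * (((L ^ k : ℕ)) : ℝ) ^ 2 ≤ ca)
    (hmc : ∀ k, (((L ^ k : ℕ)) : ℝ) ^ 2 * m k ≤ cm) (hm₁c : ∀ k, (((L ^ k : ℕ)) : ℝ) ^ 2 * m₁ k ≤ c₁)
    {a₀ : ℝ} (ha₀ : 0 < a₀) :
    TowerLimitRate (ι := fun _ => Tor M) (fun _ => (1 : Matrix (Tor M) (Tor M) ℂ)) 1
      (fun k => effSc (L ^ k) M (Rc k) (T k) a₀) (cEnd d L cw ca cm c₁) ((L : ℝ)⁻¹) := by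
  refine towerLimitRate_of_closedBrackets L M Rc T R' T' hL hT (CP' := fun _ => 136)
    (fun k f => qW_le_coarse_rel (L ^ k) M (hT₀ k) (hwin k) (hrel k) (hsmall k) f) hTcomp hRtr ha₀ w' a m m₁
    hw'0 hwc ha hac hm hmc hm₁ hm₁c fun k μ => ?_
  have h := scalar_pair_closed_local (L ^ k) L M hd (hR' k) (hT'1 k) (hm k) (hmis k) (habsorb k) (hT k) (hRc1 k) (hT₀ k) (hw k) (hwin k)
    hγ (hrel k) (hsmall k) (hw'0 k) (hw' k) (ha k) (hP k) (hm₁ k) (hin k) (hcross k) (hsmall₁ k) μ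
  simp only [eLevel, ePLevel, lamLevel, lamF, lamC, cR, eFED, eONE, eUB, delta, eps1, deltaP]
  simpa only using h

end Local

section TwoRunsLocal

variable (L : ℕ) [NeZero L] (M : Fin d → ℕ) [hM : ∀ μ, NeZero (M μ)]
variable (Rc Rb : (k : ℕ) → Tor (fine (L ^ k) M) → Fin d → ℂ) (T Tb Tb₀ : (k : ℕ) → Tor (fine (L ^ k) M) → ℂ)
variable (R' : (k : ℕ) → Tor (fine L (fine (L ^ k) M)) → Fin d → ℂ) (T' : (k : ℕ) → Tor (fine L (fine (L ^ k) M)) → ℂ)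
variable (m w w' a m₁ ρ τ : ℕ → ℝ)

/-- **THE FRAME-FREE TWO-RUNS END** (the skeleton's root R, §0, model level): as `towerLimitRate_twoRuns_closed` (p215328) with the pair's
frames replaced by leaf-01-g4's per-block P⁺ (reference `Tb₀ k`, in-block defect `w_k`, relative phase `γ`, smallness
`2d(n w_k)² + 4γ² ≤ ½`, `2d(L m₁,k)² ≤ ½`, absorption `64d(n m_k)² ≤ ½`); run-k data's UB⁺/P⁺ in leaf shape; NE3 = the two-run CLASS
`n·ρ_k ≤ c_ρ θ^k`, `τ_k ≤ c_τ θ^k` on RAW distances ⟹ `TowerLimitRate (fun _ ↦ 1) 1 (k ↦ effSc (L^k) M (Rc k) (T k) a₀)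
(cTwoRuns d L c_w′ c_a c_m c₁ c_ρ c_τ) (max L⁻¹ θ)`.  NE3 NOT discharged; NE2 NOT proved. [folklore] -/
theorem towerLimitRate_twoRuns_closed_local (hd : 1 ≤ d) (hL : 2 ≤ L)
    (hT : ∀ k x, ‖T k x‖ = 1)
    (hUBk : ∀ k (μ : Tor M → ℂ), ∃ f, Qk (L ^ k) M (T k) f = μ ∧
      Sc (L ^ k) M (Rc k) f ≤ lamC d ((((L ^ k : ℕ)) : ℝ) * w' k) * nsq μ)
    (hPk : ∀ k f, qW (L ^ k) M f ≤ (1088 * (d : ℝ) + 128) * (Sc (L ^ k) M (Rc k) f + nsq (Qk (L ^ k) M (T k) f)))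
    (hTb : ∀ k x, ‖Tb k x‖ = 1) (hRb1 : ∀ k y μ, ‖Rb k y μ‖ = 1) (hR' : ∀ k x μ, ‖R' k x μ‖ ≤ 1) (hT'1 : ∀ k x, ‖T' k x‖ = 1)
    (hTcomp : ∀ k, T (k + 1) = compT (L ^ k) L M (Tb k) (T' k)) (hRtr : ∀ k, Rc (k + 1) = Rtr (L ^ k) L M (R' k))
    (hm : ∀ k, 0 ≤ m k) (hmis : ∀ k y μ j, ‖mis L (fine (L ^ k) M) (Rb k) (R' k) (T' k) y μ j‖ ≤ m k)
    (habsorb : ∀ k, 64 * (d : ℝ) * ((((L ^ k : ℕ)) : ℝ) * m k) ^ 2 ≤ 1 / 2)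
    (hTb₀ : ∀ k x, ‖Tb₀ k x‖ = 1) (hw : ∀ k, 0 ≤ w k)
    (hwin : ∀ k (y : Tor M) (j : Fin d → Fin (L ^ k)) (μ : Fin d), (j μ : ℕ) + 1 < L ^ k →
      ‖Rb k (bpt (L ^ k) M y j) μ * (starRingEnd ℂ) (Tb₀ k (bpt (L ^ k) M y j + unitVec (fine (L ^ k) M) μ)) * Tb₀ k (bpt (L ^ k) M y j) - 1‖
        ≤ w k)
    {γ : ℝ} (hγ : γ < 1) (hrel : ∀ k x, ‖Tb k x * (starRingEnd ℂ) (Tb₀ k x) - 1‖ ≤ γ)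
    (hsmall : ∀ k, 2 * (d : ℝ) * ((((L ^ k : ℕ)) : ℝ) * w k) ^ 2 + 4 * γ ^ 2 ≤ 1 / 2)
    (hw'0 : ∀ k, 0 ≤ w' k) (hw' : ∀ k, (4 + (((L ^ k : ℕ)) : ℝ) * w k) / (1 - γ) - 1 ≤ (((L ^ k : ℕ)) : ℝ) * w' k)
    (ha : ∀ k, 0 ≤ a k)
    (hP : ∀ k x μ ν, ‖Rb k x μ * Rb k (x + unitVec (fine (L ^ k) M) μ) ν - Rb k x ν * Rb k (x + unitVec (fine (L ^ k) M) ν) μ‖ ≤ a k)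
    (hm₁ : ∀ k, 0 ≤ m₁ k)
    (hin : ∀ k (y : Tor (fine (L ^ k) M)) (j : Fin d → Fin L) (μ : Fin d), (j μ : ℕ) + 1 < L →
      ‖R' k (bpt L (fine (L ^ k) M) y j) μ * (starRingEnd ℂ) (T' k (bpt L (fine (L ^ k) M) y j + unitVec (fine L (fine (L ^ k) M)) μ))
          * T' k (bpt L (fine (L ^ k) M) y j) - 1‖ ≤ m₁ k)
    (hcross : ∀ k (y : Tor (fine (L ^ k) M)) (j : Fin d → Fin L) (μ : Fin d), (j μ : ℕ) + 1 = L →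
      ‖R' k (bpt L (fine (L ^ k) M) y j) μ * (starRingEnd ℂ) (T' k (bpt L (fine (L ^ k) M) y j + unitVec (fine L (fine (L ^ k) M)) μ))
          * T' k (bpt L (fine (L ^ k) M) y j) - Rb k y μ‖ ≤ m₁ k)
    (hsmall₁ : ∀ k, 2 * (d : ℝ) * ((L : ℝ) * m₁ k) ^ 2 ≤ 1 / 2)
    {cw ca cm c₁ : ℝ}
    (hwc : ∀ k, (((L ^ k : ℕ)) : ℝ) * w' k ≤ cw) (hac : ∀ k, a k * (((L ^ k : ℕ)) : ℝ) ^ 2 ≤ ca)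
    (hmc : ∀ k, (((L ^ k : ℕ)) : ℝ) ^ 2 * m k ≤ cm) (hm₁c : ∀ k, (((L ^ k : ℕ)) : ℝ) ^ 2 * m₁ k ≤ c₁)
    {θ cρ cτ : ℝ} (hθ0 : 0 ≤ θ) (hθ1 : θ < 1)
    (hρ0 : ∀ k, 0 ≤ ρ k) (hρ : ∀ k y μ, ‖Rb k y μ - Rc k y μ‖ ≤ ρ k) (hρc : ∀ k, (((L ^ k : ℕ)) : ℝ) * ρ k ≤ cρ * θ ^ k)
    (hτ0 : ∀ k, 0 ≤ τ k) (hτ : ∀ k x, ‖Tb k x - T k x‖ ≤ τ k) (hτc : ∀ k, τ k ≤ cτ * θ ^ k)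
    {a₀ : ℝ} (ha₀ : 0 < a₀) :
    TowerLimitRate (ι := fun _ => Tor M) (fun _ => (1 : Matrix (Tor M) (Tor M) ℂ)) 1
      (fun k => effSc (L ^ k) M (Rc k) (T k) a₀) (cTwoRuns d L cw ca cm c₁ cρ cτ) (max ((L : ℝ)⁻¹) θ) := by
  have hL2 : (2 : ℝ) ≤ L := by exact_mod_cast hL
  have hL1 : (1 : ℝ) ≤ L := by linarith
  have hLinv0 : (0 : ℝ) ≤ (L : ℝ)⁻¹ := by positivity
  have hLinv1 : (L : ℝ)⁻¹ < 1 := inv_lt_one_of_one_lt₀ (by linarith)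
  have hρ₀0 : 0 ≤ max ((L : ℝ)⁻¹) θ := le_max_of_le_left hLinv0
  have hρ₀1 : max ((L : ℝ)⁻¹) θ < 1 := max_lt hLinv1 hθ1
  have hca : 0 ≤ ca := le_trans (mul_nonneg (ha 0) (by positivity)) (hac 0)
  have hcm : 0 ≤ cm := le_trans (mul_nonneg (by positivity) (hm 0)) (hmc 0)
  have hc₁ : 0 ≤ c₁ := le_trans (mul_nonneg (by positivity) (hm₁ 0)) (hm₁c 0)
  have hcρ : 0 ≤ cρ := by
    have h := hρc 0; simp only [pow_zero, mul_one, Nat.cast_one, one_mul] at h; exact (hρ0 0).trans h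
  have hcτ : 0 ≤ cτ := by have h := hτc 0; simp only [pow_zero, mul_one] at h; exact (hτ0 0).trans h
  have hCend : 0 ≤ cEnd d L cw ca cm c₁ := cEnd_nonneg d L hca hcm hc₁
  have hClip : 0 ≤ cLip d cw cρ cτ := by
    unfold cLip; exact eFED_nonneg d (by positivity) (lamC_nonneg d _)
  have hC : 0 ≤ cTwoRuns d L cw ca cm c₁ cρ cτ := add_nonneg hCend hClip
  -- per-level P⁺ (per block, weakened to the frame constant) and UB⁺ (relative) for the coarse partner, in leaf shape
  have hPb : ∀ k f, qW (L ^ k) M f ≤ (1088 * (d : ℝ) + 128) * (Sc (L ^ k) M (Rb k) f + nsq (Qk (L ^ k) M (Tb k) f)) :=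
    fun k f => qW_le_coarse_rel_weak (L ^ k) M hd (hTb₀ k) (hwin k) (hrel k) (hsmall k) f
  have hUBb : ∀ k (μ : Tor M → ℂ), ∃ f, Qk (L ^ k) M (Tb k) f = μ ∧ Sc (L ^ k) M (Rb k) f ≤ lamC d ((((L ^ k : ℕ)) : ℝ) * w' k) * nsq μ := by
    intro k μ
    obtain ⟨f, hf, hb⟩ := exists_ub_scalarPair_rel_eff (L ^ k) M (hTb₀ k) (fun y ν => (hRb1 k y ν).le) (hw k) (hwin k) hγ (hrel k) (hw' k) μ
    exact ⟨f, hf, by unfold lamC; exact hb⟩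
  refine towerLimitRate_twoRuns_of_brackets L M Rc Rb T Tb R' T' hT hPk hTcomp hRtr ha₀ hC hρ₀0 hρ₀1
    (fun k => eLevel d L (((L ^ k : ℕ)) : ℝ) (w' k) (a k) (m k) (m₁ k)) (fun k => ePLevel d L (((L ^ k : ℕ)) : ℝ) (w' k) (a k) (m₁ k))
    (fun k => eLip d (lamC d ((((L ^ k : ℕ)) : ℝ) * w' k))
      (Real.sqrt (d : ℝ) * ((((L ^ k : ℕ)) : ℝ) * ρ k) + Real.sqrt (lamC d ((((L ^ k : ℕ)) : ℝ) * w' k)) * τ k))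
    (fun k => ?_) (fun k => ?_) (fun k μ => ?_) (fun k μ => ?_)
  · obtain ⟨hn1, hninv, ht0, ht1⟩ := level_facts L hL1 k
    have hθk0 : 0 ≤ θ ^ k := pow_nonneg hθ0 k
    have hθk1 : θ ^ k ≤ 1 := pow_le_one₀ hθ0 hθ1.le
    have h1 := (level_defects_le (d := d) L hL1 k (hw'0 k) (hwc k) (ha k) (hac k) (hm k) (hmc k) (hm₁ k) (hm₁c k)).1
    have h2 := eLip_le (d := d) (by linarith) (hw'0 k) (hwc k) (hρ0 k) (hτ0 k) hθk0 hθk1 (hρc k) (hτc k)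
    have hp1 : ((L : ℝ)⁻¹) ^ k ≤ (max ((L : ℝ)⁻¹) θ) ^ k := pow_le_pow_left₀ hLinv0 (le_max_left _ _) k
    have hp2 : θ ^ k ≤ (max ((L : ℝ)⁻¹) θ) ^ k := pow_le_pow_left₀ hθ0 (le_max_right _ _) k
    unfold cTwoRuns
    nlinarith [mul_le_mul_of_nonneg_left hp1 hCend, mul_le_mul_of_nonneg_left hp2 hClip]
  · obtain ⟨hn1, hninv, ht0, ht1⟩ := level_facts L hL1 k
    have hθk0 : 0 ≤ θ ^ k := pow_nonneg hθ0 k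
    have hθk1 : θ ^ k ≤ 1 := pow_le_one₀ hθ0 hθ1.le
    have h1 := (level_defects_le (d := d) L hL1 k (hw'0 k) (hwc k) (ha k) (hac k) (hm k) (hmc k) (hm₁ k) (hm₁c k)).2
    have h2 := eLip_le (d := d) (by linarith) (hw'0 k) (hwc k) (hρ0 k) (hτ0 k) hθk0 hθk1 (hρc k) (hτc k)
    have hp1 : ((L : ℝ)⁻¹) ^ k ≤ (max ((L : ℝ)⁻¹) θ) ^ k := pow_le_pow_left₀ hLinv0 (le_max_left _ _) k
    have hp2 : θ ^ k ≤ (max ((L : ℝ)⁻¹) θ) ^ k := pow_le_pow_left₀ hθ0 (le_max_right _ _) k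
    unfold cTwoRuns
    nlinarith [mul_le_mul_of_nonneg_left hp1 hCend, mul_le_mul_of_nonneg_left hp2 hClip]
  · have h := scalar_pair_closed_local (L ^ k) L M hd (hR' k) (hT'1 k) (hm k) (hmis k) (habsorb k) (hTb k) (hRb1 k) (hTb₀ k) (hw k)
      (hwin k) hγ (hrel k) (hsmall k) (hw'0 k) (hw' k) (ha k) (hP k) (hm₁ k) (hin k) (hcross k) (hsmall₁ k) μ
    simp only [eLevel, ePLevel, lamLevel, lamF, lamC, cR, eFED, eONE, eUB, delta, eps1, deltaP]
    simpa only using h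
  · have h := scalar_repair_abs (L ^ k) M (hρ0 k) (hρ k) (hτ0 k) (hτ k) (lamC_nonneg d _) (by positivity) (hUBk k) (hPk k) (hUBb k) (hPb k) μ
    unfold eLip
    exact h

end TwoRunsLocal

end Summit.QuantumFields.BalabanUV.T4Continuum.VariationalCovariantEndLocal

end
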